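import Mathlib

/-!
# `|Tr(Γ M)| ≤ Tr M` for `M` positive semidefinite and `Γ` unitary
(crux `QuarksAsStableAction.StableActionBridge`, item stmt-QuantumFields-9737, line `Sketch`; lead helper,
`--supports stmt-QuantumFields-9737`; the statement is ideator 2's `AbsTraceUnitaryMulPosSemidef`, card `twisted-trace-spine`)

The finite-dimensional atom behind TWISTED-TRACE DOMINATION (`|Tr (−1)^F 𝕋^L| ≤ Tr 𝕋^L` for Lüscher's positive
transfer matrix `𝕋` of Wilson lattice QCD: the modulus of the statement's time-PERIODIC Berezin partition function is
bounded by the honest antiperiodic thermal trace): for a positive semidefinite complex matrix `M` and a unitary `Γ`,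
`‖Tr(Γ M)‖ ≤ Re Tr M`.  Proof: diagonalise `M = U D U†` (`Matrix.IsHermitian.spectral_theorem`, `D = diag(λ)`,
`λ ≥ 0`); then `Tr(Γ M) = Tr(W D) = Σ λᵢ Wᵢᵢ` with `W = U† Γ U` unitary, whose entries have modulus `≤ 1`, so
`‖Tr(Γ M)‖ ≤ Σ λᵢ = Tr M`.
-/

namespace Summit.QuantumFields.QCD.Cruxes.StableActionBridge.Sketch

open scoped ComplexOrder Matrix

/-- **`|Tr(Γ M)| ≤ Tr M`** for `M` positive semidefinite and `Γ` unitary (ideator 2's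
`AbsTraceUnitaryMulPosSemidef` verbatim: `∀ n (M Γ : Matrix (Fin n) (Fin n) ℂ), M.PosSemidef →
Γ ∈ unitaryGroup → ‖(Γ * M).trace‖ ≤ (M.trace).re`). -/
theorem abs_trace_unitary_mul_posSemidef :
    ∀ (n : ℕ) (M Γ : Matrix (Fin n) (Fin n) ℂ), M.PosSemidef →
      Γ ∈ Matrix.unitaryGroup (Fin n) ℂ → ‖(Γ * M).trace‖ ≤ (M.trace).re := by
  intro n M Γ hM hΓ
  have hH : M.IsHermitian := hM.1
  set U : Matrix (Fin n) (Fin n) ℂ := (hH.eigenvectorUnitary : Matrix (Fin n) (Fin n) ℂ) with hU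
  set D : Matrix (Fin n) (Fin n) ℂ := Matrix.diagonal (RCLike.ofReal ∘ hH.eigenvalues) with hD
  have hspec : M = U * D * star U := hH.spectral_theorem
  have hUmem : U ∈ Matrix.unitaryGroup (Fin n) ℂ := hH.eigenvectorUnitary.2
  -- `W = U† Γ U` is unitary
  set W : Matrix (Fin n) (Fin n) ℂ := star U * Γ * U with hW
  have hWmem : W ∈ Matrix.unitaryGroup (Fin n) ℂ := by
    have h1 : star U ∈ Matrix.unitaryGroup (Fin n) ℂ := Unitary.star_mem hUmem
    exact Submonoid.mul_mem _ (Submonoid.mul_mem _ h1 hΓ) hUmem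
  -- `Tr(Γ M) = Tr(W D)`
  have htr : (Γ * M).trace = (W * D).trace := by
    rw [hspec, hW, ← Matrix.mul_assoc, ← Matrix.mul_assoc, Matrix.trace_mul_comm, ← Matrix.mul_assoc,
      ← Matrix.mul_assoc]
  -- `Tr(W D) = Σ λᵢ Wᵢᵢ`
  have hsum : (W * D).trace = ∑ i, W i i * (hH.eigenvalues i : ℂ) := by
    simp only [Matrix.trace, Matrix.diag, hD, Matrix.mul_diagonal, Function.comp_apply, RCLike.ofReal]
    rfl
  -- `Tr M = Σ λᵢ`
  have htrM : (M.trace).re = ∑ i, hH.eigenvalues i := by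
    rw [hH.trace_eq_sum_eigenvalues]
    simp
  rw [htr, hsum, htrM]
  refine (norm_sum_le _ _).trans (Finset.sum_le_sum fun i _ => ?_)
  rw [norm_mul, Complex.norm_real, Real.norm_eq_abs, abs_of_nonneg (hM.eigenvalues_nonneg i)]
  calc ‖W i i‖ * hH.eigenvalues i ≤ 1 * hH.eigenvalues i :=
        mul_le_mul_of_nonneg_right (entry_norm_bound_of_unitary hWmem i i) (hM.eigenvalues_nonneg i)
    _ = hH.eigenvalues i := one_mul _

end Summit.QuantumFields.QCD.Cruxes.StableActionBridge.Sketch
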